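import Literature.NumberTheory.Automorphic.TwistedQuotientIndFunShapiroNatural
import Literature.NumberTheory.Automorphic.TwistedQuotientIntegralFunctions
import HarnessLib

/-!
# Naturality of the integral functions `M̃` in the lattice `M`; the case `M = V`; scaled lattices

Topic `NumberTheory/Automorphic`; namespace `Literature.NumberTheory.Automorphic.TwistedQuotient`.
Definitions with bodies and theorems; no named fact, no instance, no `sorry`.

For lattices `M ≤ M'` in `V` (both stable under `π(L)`):

* `intFunIncl : intFun ι L π M ⟶ intFun ι L π M'` and `latticeIncl : latticeRep M → latticeRep M'`
  (an intertwining map); compatibilities with `intFunι` (`intFunIncl_comp_intFunι`), with the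
  Hecke operators (`heckeIntHom_comp_intFunIncl`) and with the untwisting isomorphisms
  (`intFunIso_hom_comp_indFunMap` : `intFunIso ≫ indFunMap latticeIncl = intFunIncl ≫ intFunIso`);
* the case `M = ⊤`: `intFunTopIso : intFun ι L π ⊤ ≅ Fun(𝒢 ⧸ L, V)_ρ` (`ρ = π ∘ ι`), so that the
  rational coefficient system is itself of induced type, `≅ indFun (latticeRep ⊤)`;
* scaled lattices `divLattice c M = {v | c • v ∈ M}` with the equivariant "multiplication by `c`"
  `smulToLattice : latticeRep (divLattice c M) → latticeRep M`, and
  `latticeIncl_divLattice_comp` : `incl_M ∘ (c •) = c • incl_{divLattice}` — so that a class coming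
  from `H^q(indFun (divLattice c M))` has its `c`-multiple coming from `H^q(indFun M)`
  (`exists_of_map_indFunMap_divLattice`).

These are the bookkeeping identities behind "`ξ ∈ H^q(X_U, Ṽ)`, `Ṽ = ⋃ p^{-t} M̃_{E'}`, so `p^t ξ`
comes from `H^q(X_U, M̃_{E'})`" in the proof of [Scholze2015, Thm. V.4.1].

## References

* P. Scholze, *On torsion in the cohomology of locally symmetric varieties*, Ann. of Math. 182
  (2015), §V.4, proof of Thm. V.4.1. [Scholze2015]
-/

noncomputable section

open CategoryTheory
open scoped Classical

universe u

namespace Literature.NumberTheory.Automorphic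

namespace TwistedQuotient

variable {A : Type u} [CommRing A] {Γ 𝒢 : Type u} [Group Γ] [Group 𝒢] (ι : Γ →* 𝒢)
  (L : Subgroup 𝒢) {V : Type u} [AddCommGroup V] [Module A V] (π : Representation A 𝒢 V)

/-! ### Inclusions of lattices -/

section Incl

variable {M M' : Submodule A V}

/-- `M̃ ⊆ M̃'` for `M ≤ M'`. [folklore] -/
theorem intFunSubmodule_mono (hMM' : M ≤ M') : intFunSubmodule L π M ≤ intFunSubmodule L π M' :=
  fun _ hf g => hMM' (hf g)

/-- **The inclusion `M̃ ⟶ M̃'`** for `M ≤ M'`. [folklore] -/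
def intFunIncl (hMM' : M ≤ M') : intFun ι L π M ⟶ intFun ι L π M' :=
  Rep.ofHom ⟨Submodule.inclusion (intFunSubmodule_mono L π hMM'),
    fun _ => LinearMap.ext fun _ => rfl⟩

/-- Unfolding lemma. [folklore] -/
@[simp]
theorem val_intFunIncl_hom_apply (hMM' : M ≤ M') (f : intFun ι L π M) :
    ((intFunIncl ι L π hMM').hom f).1 = f.1 :=
  rfl

/-- `intFunIncl ≫ intFunι = intFunι`. [folklore] -/
@[reassoc]
theorem intFunIncl_comp_intFunι (hMM' : M ≤ M') :
    intFunIncl ι L π hMM' ≫ intFunι ι L π M' = intFunι ι L π M :=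
  Rep.hom_ext (Representation.IntertwiningMap.ext (LinearMap.ext fun _ => rfl))

/-- `intFunIncl` is injective. [folklore] -/
theorem intFunIncl_injective (hMM' : M ≤ M') : Function.Injective (intFunIncl ι L π hMM').hom :=
  fun _ _ h => Subtype.ext (congrArg Subtype.val h :)

/-- The Hecke operators commute with the inclusion. [folklore] -/
@[reassoc]
theorem heckeIntHom_comp_intFunIncl (hMM' : M ≤ M') (hM : ∀ l ∈ L, ∀ m ∈ M, π l m ∈ M)
    (hM' : ∀ l ∈ L, ∀ m ∈ M', π l m ∈ M') {g₀ : 𝒢} (hg₀ : ∀ m ∈ M, π g₀ m ∈ M)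
    (hg₀' : ∀ m ∈ M', π g₀ m ∈ M') :
    heckeIntHom ι L π M hM hg₀ ≫ intFunIncl ι L π hMM' =
      intFunIncl ι L π hMM' ≫ heckeIntHom ι L π M' hM' hg₀' :=
  Rep.hom_ext (Representation.IntertwiningMap.ext (LinearMap.ext fun _ => rfl))

/-- **The inclusion `M → M'` as an intertwining map of the lattice representations.** [folklore] -/
def latticeIncl (hMM' : M ≤ M') (hM : ∀ l ∈ L, ∀ m ∈ M, π l m ∈ M)
    (hM' : ∀ l ∈ L, ∀ m ∈ M', π l m ∈ M') :
    (latticeRep L π M hM).IntertwiningMap (latticeRep L π M' hM') :=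
  ⟨Submodule.inclusion hMM', fun _ => LinearMap.ext fun _ => Subtype.ext rfl⟩

/-- Unfolding lemma. [folklore] -/
@[simp]
theorem coe_latticeIncl_apply (hMM' : M ≤ M') (hM : ∀ l ∈ L, ∀ m ∈ M, π l m ∈ M)
    (hM' : ∀ l ∈ L, ∀ m ∈ M', π l m ∈ M') (m : M) :
    (latticeIncl L π hMM' hM hM' m : V) = m :=
  rfl

/-- `latticeIncl` is injective. [folklore] -/
theorem latticeIncl_injective (hMM' : M ≤ M') (hM : ∀ l ∈ L, ∀ m ∈ M, π l m ∈ M)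
    (hM' : ∀ l ∈ L, ∀ m ∈ M', π l m ∈ M') : Function.Injective (latticeIncl L π hMM' hM hM') :=
  fun _ _ h => Subtype.ext (congrArg Subtype.val h :)

/-- **The untwisting isomorphisms are natural in the lattice**:
`intFunIso_M ≫ indFunMap (latticeIncl) = intFunIncl ≫ intFunIso_{M'}`. [folklore] -/
@[reassoc]
theorem intFunIso_hom_comp_indFunMap (hMM' : M ≤ M') (hM : ∀ l ∈ L, ∀ m ∈ M, π l m ∈ M)
    (hM' : ∀ l ∈ L, ∀ m ∈ M', π l m ∈ M') :
    (intFunIso ι L π M hM).hom ≫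
        indFunMap ι L (latticeRep L π M hM) (latticeRep L π M' hM') (latticeIncl L π hMM' hM hM') =
      intFunIncl ι L π hMM' ≫ (intFunIso ι L π M' hM').hom :=
  Rep.hom_ext (Representation.IntertwiningMap.ext (LinearMap.ext fun _ =>
    Subtype.ext (funext fun _ => Subtype.ext rfl)))

end Incl

/-! ### The case `M = V` -/

/-- Every function lies in `Ṽ = intFunSubmodule ⊤`. [folklore] -/
theorem mem_intFunSubmodule_top (f : (𝒢 ⧸ L) → V) : f ∈ intFunSubmodule L π (⊤ : Submodule A V) :=
  fun _ => Submodule.mem_top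

/-- `π(L)` trivially preserves `⊤`. [folklore] -/
theorem top_stable : ∀ l ∈ L, ∀ m ∈ (⊤ : Submodule A V), π l m ∈ (⊤ : Submodule A V) :=
  fun _ _ _ _ => Submodule.mem_top

/-- **`intFun ι L π ⊤ ≅ Fun(𝒢 ⧸ L, V)_ρ`** (`ρ = π ∘ ι`): for `M = V` the integral functions are all
functions; the isomorphism is `intFunι`. [folklore] -/
def intFunTopIso : intFun ι L π (⊤ : Submodule A V) ≅ coeffRep ι L (π.comp ι) :=
  Rep.mkIso (Representation.Equiv.mk
    { toFun := fun f => f.1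
      map_add' := fun _ _ => rfl
      map_smul' := fun _ _ => rfl
      invFun := fun f => ⟨f, mem_intFunSubmodule_top L π f⟩
      left_inv := fun _ => rfl
      right_inv := fun _ => rfl }
    fun _ => LinearMap.ext fun _ => rfl)

/-- `intFunTopIso.hom = intFunι`. [folklore] -/
theorem intFunTopIso_hom : (intFunTopIso ι L π).hom = intFunι ι L π ⊤ :=
  Rep.hom_ext (Representation.IntertwiningMap.ext (LinearMap.ext fun _ => rfl))

/-- Unfolding lemma for the inverse. [folklore] -/
@[simp]
theorem val_intFunTopIso_inv_hom_apply (f : (𝒢 ⧸ L) → V) :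
    ((intFunTopIso ι L π).inv.hom f).1 = f :=
  rfl

/-- The Hecke operators correspond under `intFunTopIso`. [folklore] -/
@[reassoc]
theorem intFunTopIso_hom_comp_heckeRepHom (g₀ : 𝒢) :
    (intFunTopIso ι L π).hom ≫ heckeRepHom ι L (π.comp ι) g₀ =
      heckeIntHom ι L π ⊤ (top_stable L π) (g₀ := g₀) (fun _ _ => Submodule.mem_top) ≫
        (intFunTopIso ι L π).hom := by
  rw [intFunTopIso_hom]
  exact (heckeIntHom_comp_intFunι ι L π ⊤ (top_stable L π) (g₀ := g₀)
    (fun _ _ => Submodule.mem_top)).symm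

/-! ### Scaled lattices `{v | c • v ∈ M}` -/

section Div

variable (c : A) (M : Submodule A V) (hM : ∀ l ∈ L, ∀ m ∈ M, π l m ∈ M)

/-- **The scaled lattice `c⁻¹ M = {v | c • v ∈ M}`** (for `c = p^t`: `p^{-t} M`). [folklore] -/
def divLattice : Submodule A V :=
  M.comap (DistribSMul.toLinearMap A V c)

/-- Membership in `divLattice`. [folklore] -/
theorem mem_divLattice_iff (v : V) : v ∈ divLattice c M ↔ c • v ∈ M :=
  Iff.rfl

/-- `M ≤ c⁻¹ M`. [folklore] -/
theorem le_divLattice : M ≤ divLattice c M := fun v hv =>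
  (mem_divLattice_iff c M v).2 (M.smul_mem c hv)

include hM in
/-- `c⁻¹ M` is stable under `π(L)`. [folklore] -/
theorem divLattice_stable : ∀ l ∈ L, ∀ m ∈ divLattice c M, π l m ∈ divLattice c M :=
  fun l hl m hm => by
    rw [mem_divLattice_iff, ← map_smul]
    exact hM l hl _ hm

/-- **Multiplication by `c`, `c⁻¹ M → M`**, an intertwining map of the lattice representations.
[folklore] -/
def smulToLattice :
    (latticeRep L π (divLattice c M) (divLattice_stable L π c M hM)).IntertwiningMap
      (latticeRep L π M hM) :=
  ⟨{ toFun := fun v => ⟨c • (v : V), v.2⟩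
     map_add' := fun v w => Subtype.ext (smul_add c (v : V) (w : V))
     map_smul' := fun a v => Subtype.ext (smul_comm c a (v : V)) },
    fun l => LinearMap.ext fun v => Subtype.ext (by
      change c • π l (v : V) = π l (c • (v : V))
      rw [map_smul])⟩

/-- Unfolding lemma. [folklore] -/
@[simp]
theorem coe_smulToLattice_apply (v : divLattice c M) :
    (smulToLattice L π c M hM v : V) = c • (v : V) :=
  rfl

/-- `incl ∘ (c •) = c • incl` as intertwining maps `c⁻¹M → M'` for `M ≤ M'` containing `c⁻¹ M`:
here with `M' ⊇ divLattice c M` an ambient lattice (e.g. `⊤`). [folklore] -/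
theorem indFunMap_smulToLattice_comp {M' : Submodule A V} (hM' : ∀ l ∈ L, ∀ m ∈ M', π l m ∈ M')
    (hMM' : M ≤ M') (hdM' : divLattice c M ≤ M') :
    indFunMap ι L _ _ (smulToLattice L π c M hM) ≫ indFunMap ι L _ _ (latticeIncl L π hMM' hM hM') =
      c • indFunMap ι L _ _ (latticeIncl L π hdM' (divLattice_stable L π c M hM) hM') := by
  refine Rep.hom_ext (Representation.IntertwiningMap.ext (LinearMap.ext fun F => ?_))
  exact Subtype.ext (funext fun g => Subtype.ext rfl)

/-- **A class from `H^q(indFun (c⁻¹M))` has its `c`-multiple coming from `H^q(indFun M)`**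
(inside `H^q(indFun M')` for an ambient lattice `M'`, e.g. `M' = ⊤`), for `c : ℕ`.
[cite: Scholze2015, §V.4 (proof of Thm. V.4.1)] -/
theorem exists_of_map_indFunMap_divLattice (c : ℕ) {M' : Submodule A V}
    (hM' : ∀ l ∈ L, ∀ m ∈ M', π l m ∈ M') (hMM' : M ≤ M') (hdM' : divLattice (c : A) M ≤ M')
    (q : ℕ) (x : groupCohomology (indFun ι L (latticeRep L π M' hM')) q)
    (y : groupCohomology (indFun ι L (latticeRep L π (divLattice (c : A) M)
      (divLattice_stable L π (c : A) M hM))) q)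
    (hy : (groupCohomology.functor A Γ q).map
      (indFunMap ι L _ _ (latticeIncl L π hdM' (divLattice_stable L π (c : A) M hM) hM')) y = x) :
    ∃ z : groupCohomology (indFun ι L (latticeRep L π M hM)) q,
      (groupCohomology.functor A Γ q).map (indFunMap ι L _ _ (latticeIncl L π hMM' hM hM')) z =
        c • x := by
  refine ⟨(groupCohomology.functor A Γ q).map (indFunMap ι L _ _ (smulToLattice L π (c : A) M hM)) y,
    ?_⟩
  change ((groupCohomology.functor A Γ q).map (indFunMap ι L _ _ (smulToLattice L π (c : A) M hM)) ≫
    (groupCohomology.functor A Γ q).map (indFunMap ι L _ _ (latticeIncl L π hMM' hM hM'))) y = _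
  rw [← Functor.map_comp, indFunMap_smulToLattice_comp ι L π (c : A) M hM hM' hMM' hdM', ← hy]
  have h : ((c : A) • indFunMap ι L _ _ (latticeIncl L π hdM' (divLattice_stable L π (c : A) M hM) hM') :
      indFun ι L _ ⟶ indFun ι L (latticeRep L π M' hM')) =
      ∑ _i : Fin c, indFunMap ι L _ _ (latticeIncl L π hdM' (divLattice_stable L π (c : A) M hM) hM') := by
    rw [Finset.sum_const, Finset.card_fin, ← Nat.cast_smul_eq_nsmul A]
  rw [h, groupCohomology.functor_map, Literature.Algebra.Homology.map_id_sum]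
  change (∑ _i : Fin c, groupCohomology.map (MonoidHom.id Γ)
      (indFunMap ι L _ _ (latticeIncl L π hdM' (divLattice_stable L π (c : A) M hM) hM')) q).hom y =
    c • _
  rw [ModuleCat.hom_sum, LinearMap.sum_apply, Finset.sum_const, Finset.card_fin]
  rfl

end Div

end TwistedQuotient

end Literature.NumberTheory.Automorphic
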